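import Summits.BirchSwinnertonDyer.Rank1Residual.AdditivePotMult.PotMultBudgetRankZeroEnds
import Summits.BirchSwinnertonDyer.Rank1Residual.Additive.BranchPAdicGrossZagierIff
import Summits.BirchSwinnertonDyer.Rank1Residual.Additive.GordRankOneKatoUpperBound
import HarnessLib

/-!
# X4(M) ∧ surj(p) ∧ `r_an = 1`, EVERY odd `p` (`p = 3` included): on the INDEX-`n₀` rows of Route G the
# residue of `BSD(E,p)` is EXACTLY the typed `p`-adic Gross–Zagier formula at the additive prime —
# `BSDp ⟺ ∀ (B)-data, BranchPAdicGrossZagierMultAt` from Kato's divisibility + the census record at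
# index `n₀` + the budget `n₀ ≤ λ` + ONE one-sided bit `c₁ ≠ 0` (cell `b2b-bsdres`, team n1011, seat p07
# (gen 3), row T-E3gM = route planner 2's ROUTE-2 §II.12 (M) halves, dealt by lead GEN 6 R5-30; FILE 2c
# of T-E3dM; the rank-ONE ends, twin of the rank-zero ends `PotMultBudgetRankZeroEnds.lean`)

HONEST FRAMING (cell `b2b-bsdres`, run/shared/lean/b2b/bsd-rank1-residual/, verbatim in every
file): the goal of the cell is to DELETE the COMBINATION-SHAPED residual classes of the
Birch–Swinnerton-Dyer formula for ALL analytic-rank `≤ 1` elliptic curves over `ℚ` — "full BSD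
formula for every rank `≤ 1` curve in class `C`" assembled STRICTLY from published theorems — so
that the rank-`≤ 1` remainder becomes exactly the CONSTRUCTION-SHAPED classes, which are TYPED
(missing-input `Prop`s), NOT attempted. This is not "finishing BSD". Team n1011 (RESIDUAL-MAP §I O7-ord
on the (M) rows = X4(M) ∧ surj(p) ∧ `r_an = 1`, every odd `p`): research route on CONSTRUCTION-SHAPED
items; O7-ord stays OPEN and CONSTRUCTION-SHAPED; labels and marks UNCHANGED; nothing booked — the
OUTPUT below is `BSDp ↔ typed p-adic GZ`, NOT `BSD(E,p)`; every statement is PER PAIR modulo the named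
facts AND per-pair inputs outside the kernel: the census record (CERTIFICATE-EVIDENCE, two engines),
the budget (n1011-p10's typed `BudgetLeLambdaAt`, EPW 2006 §3 per curve — or a theorem when
`n₀ ≤ rank`, or a partner), and the ONE-SIDED bit `c₁(ϖ·B) ≠ 0` (a non-zero `p`-adic digit below the
working precision; "`c₁ ≡ 0 (mod p^M)`" is UNDECIDED, never "false"). NO Literature fact minted; NO
definition (the bit is an explicit binder in the census-literal shape of `MultBranchUnitCertificateAt`;
the (G-ord) def of record is additive-p2's `BranchCoeffOneNeZeroAt`). Named facts as HYPOTHESES only: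
`hK` (Kato 2004 Thm. 17.4 (3) half-eigenspace reading
`Wuthrich2014.kato_halfEigenCharIdeal_dvd_cyclotomicPrime_of_surjective`), `hDelM` (Delbourgo 2002
Thm. (A)+(B), (M) form `Delbourgo2002.mainTheorem_potMult`), `hGZK`, `hmod`, `hmodD`. Debt 0.

## What and why (ROUTE-2 §II.12.0–II.12.1, r2 GEN 6)

Route G's kernel is RANK-AGNOSTIC: on an `r_an = 1` (M) row, Kato's divisibility + ONE unit
coefficient at index `n₀` (census-ctyper1's record `CensusQ6.Mult[Odd]FirstUnitIndexAt W p n₀`) + the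
typed lower bound `BudgetLeLambdaAt p W n₀` give the MAIN CONJECTURE on the branch and n1011-p10's typed
LOWER `QuadraticBranchLowerDivisibilityAt V p` for every twist model
(`PotMultCongruentPartnerMainConjecture` §2) — the binder `hc` of n1011-p01's IMC-version iff
`ClassX4M.bsdp_iff_forall_branchPAdicGrossZagierMultAt_of_quadraticBranchLower_of_katoHalf`
(`Additive/BranchPAdicGrossZagierIff.lean` §4). Its other per-pair binder `hSall` ("Schneider for every
(B)-datum") is the RIDER: on index-`1`-certified rows it came from `λ ≤ 1` (T-O7KM); on index-`n₀ ≥ 3`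
rows `λ = n₀ > rank` and ONLY the exact bit `c₁(ϖ·B) ≠ 0` gives it — additive-p2's cell-agnostic
`schneider_and_padicVal_le_rankOne_of_iota_eq` (`g ∈ char_Λ X`, `ι g = C(u·ϖ)·B`, `c₁ ≠ 0`, `rank = 1`
⟹ `ord_{T=0} fE = 1` ⟹ clause 2 of `LeadingTermClauses`).

* §1 `ClassX4M.forall_schneider_of_katoHalf_of_multCoeffOneNeZero`: X4(M) ∧ surj(p) ∧ `r_an = 1`,
  `hK`, `hmodD`, `hGZK` + the bit ⟹ `∀ Dh, LeadingTermClauses W p Dh → SchneiderConjecture Dh` (and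
  `Ш[p^∞]` finite), every odd `p`; `coeff_multBranch_ne_zero_of_firstUnitIndex`: the record at index
  `n` supplies the bit at index `n` (so at `n₀ = 1` the record IS the bit).
* §2 CAPSTONE `ClassX4M.bsdp_iff_forall_branchPAdicGrossZagierMultAt_of_katoHalf_of_firstUnitIndex_of_budget`
  (every odd `p`): p01's iff with `hc` REPLACED by record(`n₀`) + `BudgetLeLambdaAt p W n₀` and `hSall`
  REPLACED by the bit — `BSDp W p ↔ ∀ Dh, LeadingTermClauses W p Dh → BranchPAdicGrossZagierMultAt W p Dh`;
  the `p = 3` specialisation; and the index-`1` form `…_of_firstUnitIndex_one` with NO budget and NO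
  bit (`n₀ = 1 = rank`: `budgetLeLambdaAt_of_le_mordellWeilRank`; the record's unit IS the bit) — the
  IMC-version companion of n1011-p17's per-datum CERT-literal iff (S6) on T-O7KM's rows.

What is NOT claimed: `BSD(E,p)` on any row (the typed `p`-adic GZ at the additive prime is the
residue: O7-ord, CONSTRUCTION-SHAPED; `Reg_p(E,Dh)` has NO engine in the cell); the record / budget /
bit inputs (instrument tier, per pair); rows with `n₀ > m(B)` and no partner (MC-open); non-surjective
rows (O8); `p = 2`; the `v₁`-identity per admissible datum (needs `char = (g)` — n1011-p01's
T-E3g (ii) rider of record, composed here when it lands). Nothing booked; no number closes anything.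

References: K. Kato, Astérisque 295 (2004) Thm. 17.4 (3) [Kato2004Asterisque]; D. Delbourgo,
J. Number Theory 95 (2002) Thm. (A), (B) [Delbourgo2002]; M. Emerton, R. Pollack, T. Weston, Invent.
Math. 163 (2006) §3 [EmertonPollackWeston2006]; B. Mazur, J. Tate, J. Teitelbaum, Invent. Math. 84
(1986) §I.13–I.14 [MazurTateTeitelbaum1986Invent]; R. Greenberg, LNM 1716 (1999) §3 Lemma 3.1
[GreenbergLNM1716]; P. Schneider, Invent. Math. 79 (1985) [Schneider1985]; R. L. Miller, LMS J.
Comput. Math. 14 (2011) Def. 1.1 [Miller2011LMS].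
-/

set_option autoImplicit false

noncomputable section

open scoped Classical MatrixGroups ModularForm NumberField

namespace Summit.BirchSwinnertonDyer.Rank1Residual.AdditivePotMult

open CongruenceSubgroup WeierstrassCurve NumberField Literature.NumberTheory.EllipticCurves
  Literature.NumberTheory.EllipticCurves.ModularForms
  Literature.NumberTheory.EllipticCurves.Rank1Residual
  Literature.NumberTheory.EllipticCurves.Rank1Residual.Typed
  Literature.NumberTheory.EllipticCurves.Delbourgo2002
  Literature.NumberTheory.GaloisRepresentations
  Summit.BirchSwinnertonDyer.Rank1Residual.Additive
  Summit.BirchSwinnertonDyer.Rank1Residual.Additive.CensusQ6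
  IsDedekindDomain

/-! ### §1 The rider on (M) rows: Schneider for every (B)-datum from the one-sided bit `c₁ ≠ 0` -/

section Rider

variable {W : WeierstrassCurve ℚ} [W.IsElliptic] {p : ℕ} [hp : Fact p.Prime]

omit [W.IsElliptic] in
/-- **The record at index `n` supplies the bit at index `n`** (parity-uniform form): on every
multiplicative twist datum `(V, C, f, a_p, ϖ)` of `W` the `n`-th coefficient of the Néron-normalised
branch `ϖ·L_p^±(f, a_p, ω^{(p−1)/2}, T)` is non-zero (it is a `p`-adic unit by clause (2) of the record
of the parity of `(p−1)/2`). [cite: MazurTateTeitelbaum1986Invent, §I.13 (the branch series)] -/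
theorem coeff_multBranch_ne_zero_of_firstUnitIndex (hp2 : p ≠ 2) {n : ℕ}
    (hrec : (p % 4 = 1 → MultFirstUnitIndexAt W p n) ∧ (p % 4 = 3 → MultOddFirstUnitIndexAt W p n))
    (V : WeierstrassCurve ℚ) [V.IsElliptic] [V.IsGloballyMinimal] (C : VariableChange ℚ)
    (hV : Mult V p) (hC : C • V.quadraticTwist ((-1 : ℚ) ^ (p / 2) * p) = W)
    {N : ℕ} [NeZero N] (f : CuspForm (Gamma0 N) 2) (hf : IsNewformOf V f) (ap : ℤ)
    (hap : cuspCoeff f p = ap) (ϖ : ℚ)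
    (hϖ : if Even (p / 2) then (ϖ : ℝ) * V.realPeriodRat = plusPeriod f
      else (ϖ : ℝ) * V.imaginaryPeriodRat = minusPeriod f) :
    PowerSeries.coeff n (PowerSeries.C (ϖ : ℚ_[p]) *
        (if Even (p / 2) then padicLFunctionPlusBranchMult f (ap : ℚ_[p]) (p / 2)
          else padicLFunctionMinusBranchMult f (ap : ℚ_[p]) (p / 2))) ≠ 0 := by
  have h4 : p % 4 = 1 ∨ p % 4 = 3 := by
    obtain ⟨k, hk⟩ := hp.out.odd_of_ne_two hp2
    omega
  rcases h4 with h1 | h3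
  · have heven : Even (p / 2) := ⟨p / 4, by omega⟩
    have hC' : C • V.quadraticTwist (p : ℚ) = W := by
      rw [pStar_eq_self_of_mod_four_eq_one h1] at hC; exact hC
    rw [if_pos heven] at hϖ ⊢
    have h := (hrec.1 h1 V C hV hC' f hf ap hap ϖ hϖ).2
    intro h0
    rw [h0, norm_zero] at h
    exact zero_ne_one h
  · have hodd : ¬ Even (p / 2) := by rw [Nat.not_even_iff_odd]; exact ⟨p / 4, by omega⟩
    have hC' : C • V.quadraticTwist (-(p : ℚ)) = W := by
      rw [pStar_eq_neg_of_mod_four_eq_three h3] at hC; exact hC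
    rw [if_neg hodd] at hϖ ⊢
    have h := (hrec.2 h3 V C hV hC' f hf ap hap ϖ hϖ).2
    intro h0
    rw [h0, norm_zero] at h
    exact zero_ne_one h

/-- **THE RIDER on X4(M) ∧ surj(p) ∧ `r_an = 1`, EVERY odd `p` (`p = 3` included): Schneider's
`Reg_p(E,Dh) ≠ 0` for EVERY (B)-datum `Dh`, from Kato's divisibility and the ONE-SIDED bit `c₁ ≠ 0`** —
the linear coefficient of the Néron-normalised branch of the multiplicative twist is non-zero on
every twist datum (`hne`, census-literal binder; implied by `MultBranchUnitCertificateAt W p` and by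
any record at index `1`). Route: the multiplicative twist model, the modular parametrisation, the
tower from surj(p), the brick `isTorsion_and_exists_iota_eq_of_katoHalf` (`g ∈ char_Λ X(E/ℚ_∞)`,
`ι g = C(u·ϖ)·B`), `rank E(ℚ) = 1` (GZK), and additive-p2's cell-agnostic
`schneider_and_padicVal_le_rankOne_of_iota_eq` (`ord_{T=0} fE ≤ 1 = rank` ⟹ clause 2 of the
(B)-clauses ⟹ Schneider ∧ `Ш[p^∞]` finite). No `λ ≤ 1`: valid on index-`n₀ ≥ 3` rows.
[cite: Kato2004Asterisque, Thm. 17.4 (3) (p. 273)] [cite: Delbourgo2002, Theorem (B) (p. 40)]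
[cite: Schneider1985, Thm. 2′ (shape; nothing asserted)] -/
theorem ClassX4M.forall_schneider_of_katoHalf_of_multCoeffOneNeZero
    (hK : Wuthrich2014.kato_halfEigenCharIdeal_dvd_cyclotomicPrime_of_surjective)
    (hmodD : nonempty_modularParametrizationData)
    (hGZK : rank_eq_analyticRank_of_analyticRank_le_one)
    (hX : ClassX4M W p) (hsurj : Surj W p) (hr : W.analyticRank = 1)
    (hne : ∀ (V : WeierstrassCurve ℚ) [V.IsElliptic] [V.IsGloballyMinimal] (C : VariableChange ℚ),
      Mult V p → C • V.quadraticTwist ((-1 : ℚ) ^ (p / 2) * p) = W →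
      ∀ {N : ℕ} [NeZero N] (f : CuspForm (Gamma0 N) 2), IsNewformOf V f → ∀ (ap : ℤ), cuspCoeff f p = ap →
      ∀ ϖ : ℚ, (if Even (p / 2) then (ϖ : ℝ) * V.realPeriodRat = plusPeriod f
          else (ϖ : ℝ) * V.imaginaryPeriodRat = minusPeriod f) →
        PowerSeries.coeff 1 (PowerSeries.C (ϖ : ℚ_[p]) *
            (if Even (p / 2) then padicLFunctionPlusBranchMult f (ap : ℚ_[p]) (p / 2)
              else padicLFunctionMinusBranchMult f (ap : ℚ_[p]) (p / 2))) ≠ 0)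
    {Dh : PAdicHeightData W p} (hB : LeadingTermClauses W p Dh) :
    SchneiderConjecture Dh ∧ Finite (AddCommGroup.primaryComponent W.sha p) := by
  obtain ⟨hmw, -⟩ := hGZK W (by rw [hr])
  have hr1 : W.mordellWeilRank = 1 := by rw [hmw, hr]
  have hp2 : p ≠ 2 := hX.p_ne_two
  obtain ⟨V, iV, iVm, C, hV, hC⟩ := hX.exists_mult_pStar_twist_model
  haveI : NeZero (V.conductorNorm ℤ) := ⟨(V.conductorNorm_pos_holds).ne'⟩
  obtain ⟨Dm⟩ := hmodD V
  obtain ⟨ϖ, hϖ⟩ := exists_periodRatio_parity (p := p) V Dm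
  have hsurjV : ∀ n : ℕ, V.HasSurjectiveModNGaloisRep (p ^ n : ℕ) :=
    (ClassX4M.potMult W p hX).towerSurj_twist_of_surj hp2 hsurj V C hC
  obtain ⟨κ, hκ, γ, hγ, hγ'⟩ := exists_isCyclotomic_isTopGenerator_isCyclotomicVariable_holds p
  obtain ⟨D⟩ := W.nonempty_selmerDualData_holds κ γ hγ
  haveI : Module.Finite (IwasawaAlgebra p) D.X := D.module_finite_holds hγ
  obtain ⟨fE, hchar, -⟩ := exists_charIdeal_eq_span_singleton p D
  by_cases hs : V.HasSplitMultiplicativeReductionAtPrime p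
  · obtain ⟨hap, -⟩ := Dm.isNewformOf.cuspCoeff_eq_one_and_sq_of_split hs
    obtain ⟨hXt, g, hg, u, hι⟩ := isTorsion_and_exists_iota_eq_of_katoHalf hK hp2 V C hC hsurjV hκ hγ hγ'
      Dm.isNewformOf D _ (Or.inr (Or.inl ⟨hs, rfl⟩)) ϖ hϖ
    have h1 := hne V C hV hC Dm.f Dm.isNewformOf 1 (by exact_mod_cast hap) ϖ hϖ
    rw [Int.cast_one] at h1
    obtain ⟨hS, hfin, -⟩ :=
      schneider_and_padicVal_le_rankOne_of_iota_eq hp2 hr1 hB hκ hγ hγ' D hXt hchar hg hι h1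
    exact ⟨hS, hfin⟩
  · obtain ⟨hap, -⟩ := Dm.isNewformOf.cuspCoeff_eq_neg_one_and_dvd_of_nonsplit hV hs
    obtain ⟨hXt, g, hg, u, hι⟩ := isTorsion_and_exists_iota_eq_of_katoHalf hK hp2 V C hC hsurjV hκ hγ hγ'
      Dm.isNewformOf D _ (Or.inr (Or.inr ⟨hV, hs, rfl⟩)) ϖ hϖ
    have h1 := hne V C hV hC Dm.f Dm.isNewformOf (-1) (by exact_mod_cast hap) ϖ hϖ
    rw [Int.cast_neg, Int.cast_one] at h1
    obtain ⟨hS, hfin, -⟩ :=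
      schneider_and_padicVal_le_rankOne_of_iota_eq hp2 hr1 hB hκ hγ hγ' D hXt hchar hg hι h1
    exact ⟨hS, hfin⟩

end Rider

/-! ### §2 The CAPSTONE: `BSDp ⟺ ∀ (B)-data, typed p-adic GZ` on the index-`n₀` rows of Route G -/

section Capstone

variable {W : WeierstrassCurve ℚ} [W.IsElliptic] [W.IsGloballyMinimal] {p : ℕ} [hp : Fact p.Prime]

/-- **CAPSTONE (ROUTE-2 §II.12.1 (v), (M) half), X4(M) ∧ surj(p) ∧ `r_an = 1`, EVERY odd `p` (`p = 3`
included):** given Kato's divisibility `hK`, Delbourgo 2002 (M) `hDelM`, GZK, modularity, the census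
record at index `n₀` (parity of `(p−1)/2`; CERTIFICATE-EVIDENCE), n1011-p10's budget
`BudgetLeLambdaAt p W n₀` (typed per curve; a theorem when `n₀ ≤ rank`, `budgetLeLambdaAt_of_le_mordellWeilRank`;
or from a partner, `budgetLeLambdaAt_of_congruentLambdaShift` / `…_of_epw_of_partnerRank`) and the
one-sided bit `c₁ ≠ 0` (`hne`):
**`BSD(E,p) ⟺ ∀ Dh, LeadingTermClauses W p Dh → BranchPAdicGrossZagierMultAt W p Dh`** — the row is
REDUCED to the typed `p`-adic Gross–Zagier formula at the additive prime (O7-ord, CONSTRUCTION-SHAPED,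
UNCHANGED). n1011-p01's iff with `hc` := `PotMultCongruentPartnerMainConjecture` §2 and `hSall` := §1.
[cite: Kato2004Asterisque, Thm. 17.4 (3) (p. 273)] [cite: Delbourgo2002, Theorem (A), (B) (p. 40)]
[cite: EmertonPollackWeston2006, Cor. 3.2.5 and Thm. 3.1.1 (source of the typed input)] [cite: Miller2011LMS, Def. 1.1] -/
theorem ClassX4M.bsdp_iff_forall_branchPAdicGrossZagierMultAt_of_katoHalf_of_firstUnitIndex_of_budget
    (hDelM : Delbourgo2002.mainTheorem_potMult)
    (hK : Wuthrich2014.kato_halfEigenCharIdeal_dvd_cyclotomicPrime_of_surjective)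
    (hmod : hasEntireLFunction_rat) (hmodD : nonempty_modularParametrizationData)
    (hGZK : rank_eq_analyticRank_of_analyticRank_le_one)
    (hX : ClassX4M W p) (hsurj : Surj W p) (hr : W.analyticRank = 1) {n₀ : ℕ}
    (hrec : (p % 4 = 1 → MultFirstUnitIndexAt W p n₀) ∧ (p % 4 = 3 → MultOddFirstUnitIndexAt W p n₀))
    (hbud : BudgetLeLambdaAt p W n₀)
    (hne : ∀ (V : WeierstrassCurve ℚ) [V.IsElliptic] [V.IsGloballyMinimal] (C : VariableChange ℚ),
      Mult V p → C • V.quadraticTwist ((-1 : ℚ) ^ (p / 2) * p) = W →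
      ∀ {N : ℕ} [NeZero N] (f : CuspForm (Gamma0 N) 2), IsNewformOf V f → ∀ (ap : ℤ), cuspCoeff f p = ap →
      ∀ ϖ : ℚ, (if Even (p / 2) then (ϖ : ℝ) * V.realPeriodRat = plusPeriod f
          else (ϖ : ℝ) * V.imaginaryPeriodRat = minusPeriod f) →
        PowerSeries.coeff 1 (PowerSeries.C (ϖ : ℚ_[p]) *
            (if Even (p / 2) then padicLFunctionPlusBranchMult f (ap : ℚ_[p]) (p / 2)
              else padicLFunctionMinusBranchMult f (ap : ℚ_[p]) (p / 2))) ≠ 0) :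
    BSDp W p ↔
      ∀ Dh : PAdicHeightData W p, LeadingTermClauses W p Dh → BranchPAdicGrossZagierMultAt W p Dh :=
  hX.bsdp_iff_forall_branchPAdicGrossZagierMultAt_of_quadraticBranchLower_of_katoHalf hDelM hK hmod hmodD
    hGZK hsurj hr
    (fun V _ _ hVW ↦
      hX.forall_quadraticBranchLowerDivisibilityAt_of_katoHalf_of_firstUnitIndex_of_budget' hK hsurj hrec
        hbud V hVW)
    (fun _ hB ↦ (hX.forall_schneider_of_katoHalf_of_multCoeffOneNeZero hK hmodD hGZK hsurj hr hne hB).1)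

/-- **`p = 3` specialisation** (the O7-ord (M) rows at `3`: 2 998 `r_an = 1` (M) rows of r2's U3, 1 998 of
them forced-blind for every index-`1` programme — EVIDENCE counts of ROUTE-2 §II.12.0 (4); NO number is
quoted as closing anything): record `MultOddFirstUnitIndexAt W 3 n₀` + budget + bit ⟹
`BSD(E,3) ⟺ ∀ Dh, LeadingTermClauses W 3 Dh → BranchPAdicGrossZagierMultAt W 3 Dh`.
[cite: Kato2004Asterisque, Thm. 17.4 (3) (p. 273)] [cite: Delbourgo2002, Theorem (A), (B) (p. 40)] -/
theorem ClassX4M.bsdp_three_iff_forall_branchPAdicGrossZagierMultAt_of_katoHalf_of_firstUnitIndex_of_budget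
    [Fact (Nat.Prime 3)] {W : WeierstrassCurve ℚ} [W.IsElliptic] [W.IsGloballyMinimal]
    (hDelM : Delbourgo2002.mainTheorem_potMult)
    (hK : Wuthrich2014.kato_halfEigenCharIdeal_dvd_cyclotomicPrime_of_surjective)
    (hmod : hasEntireLFunction_rat) (hmodD : nonempty_modularParametrizationData)
    (hGZK : rank_eq_analyticRank_of_analyticRank_le_one)
    (hX : ClassX4M W 3) (hsurj : Surj W 3) (hr : W.analyticRank = 1) {n₀ : ℕ}
    (hrec : MultOddFirstUnitIndexAt W 3 n₀) (hbud : BudgetLeLambdaAt 3 W n₀)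
    (hne : ∀ (V : WeierstrassCurve ℚ) [V.IsElliptic] [V.IsGloballyMinimal] (C : VariableChange ℚ),
      Mult V 3 → C • V.quadraticTwist ((-1 : ℚ) ^ (3 / 2) * (3 : ℕ)) = W →
      ∀ {N : ℕ} [NeZero N] (f : CuspForm (Gamma0 N) 2), IsNewformOf V f → ∀ (ap : ℤ), cuspCoeff f 3 = ap →
      ∀ ϖ : ℚ, (if Even (3 / 2) then (ϖ : ℝ) * V.realPeriodRat = plusPeriod f
          else (ϖ : ℝ) * V.imaginaryPeriodRat = minusPeriod f) →
        PowerSeries.coeff 1 (PowerSeries.C (ϖ : ℚ_[3]) *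
            (if Even (3 / 2) then padicLFunctionPlusBranchMult f (ap : ℚ_[3]) (3 / 2)
              else padicLFunctionMinusBranchMult f (ap : ℚ_[3]) (3 / 2))) ≠ 0) :
    BSDp W 3 ↔
      ∀ Dh : PAdicHeightData W 3, LeadingTermClauses W 3 Dh → BranchPAdicGrossZagierMultAt W 3 Dh :=
  hX.bsdp_iff_forall_branchPAdicGrossZagierMultAt_of_katoHalf_of_firstUnitIndex_of_budget hDelM hK hmod
    hmodD hGZK hsurj hr ⟨fun h ↦ absurd h (by norm_num), fun _ ↦ hrec⟩ hbud hne

/-- **Index `1` (T-O7KM's certified rows): NO budget and NO separate bit.** X4(M) ∧ surj(p) ∧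
`r_an = 1`, EVERY odd `p`, record at index `1` ⟹
`BSD(E,p) ⟺ ∀ Dh, LeadingTermClauses W p Dh → BranchPAdicGrossZagierMultAt W p Dh` — `n₀ = 1 = rank E(ℚ)`
(GZK) makes the budget a theorem (`budgetLeLambdaAt_of_le_mordellWeilRank`) and the record's unit at
index `1` IS the bit (`coeff_multBranch_ne_zero_of_firstUnitIndex`). The IMC-version (∀-datum)
companion of n1011-p17's per-datum CERT-literal iff (S6) on the same rows; nothing new is covered.
[cite: Kato2004Asterisque, Thm. 17.4 (3) (p. 273)] [cite: Delbourgo2002, Theorem (A), (B) (p. 40)]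
[cite: GreenbergLNM1716, §3 Lemma 3.1 (T^{rank} ∣ char)] -/
theorem ClassX4M.bsdp_iff_forall_branchPAdicGrossZagierMultAt_of_katoHalf_of_firstUnitIndex_one
    (hDelM : Delbourgo2002.mainTheorem_potMult)
    (hK : Wuthrich2014.kato_halfEigenCharIdeal_dvd_cyclotomicPrime_of_surjective)
    (hmod : hasEntireLFunction_rat) (hmodD : nonempty_modularParametrizationData)
    (hGZK : rank_eq_analyticRank_of_analyticRank_le_one)
    (hX : ClassX4M W p) (hsurj : Surj W p) (hr : W.analyticRank = 1)
    (hrec : (p % 4 = 1 → MultFirstUnitIndexAt W p 1) ∧ (p % 4 = 3 → MultOddFirstUnitIndexAt W p 1)) :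
    BSDp W p ↔
      ∀ Dh : PAdicHeightData W p, LeadingTermClauses W p Dh → BranchPAdicGrossZagierMultAt W p Dh :=
  hX.bsdp_iff_forall_branchPAdicGrossZagierMultAt_of_katoHalf_of_firstUnitIndex_of_budget hDelM hK hmod
    hmodD hGZK hsurj hr hrec
    (budgetLeLambdaAt_of_le_mordellWeilRank (by rw [(hGZK W (by rw [hr])).1, hr]))
    (fun V _ _ C hV hC _ _ f hf ap hap ϖ hϖ ↦
      coeff_multBranch_ne_zero_of_firstUnitIndex hX.p_ne_two hrec V C hV hC f hf ap hap ϖ hϖ)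

end Capstone

end Summit.BirchSwinnertonDyer.Rank1Residual.AdditivePotMult

end
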